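import Literature.AnabelianGeometry.SemiGraphs.SubgroupPresentationCosetGraph
import Literature.AnabelianGeometry.SemiGraphs.SemiGraphIsoTransport
import HarnessLib

/-!
# Coset semi-graphs along a homomorphism onto a given target presentation ([SemiAnbd] §3 p. 41)

Mochizuki, *Semi-graphs of anabelioids*, Publ. RIMS **42** (2006), §3 proof of Thm. 3.7 (iii) p. 41
("compatible maps `𝒢_{∞,j} → 𝒢_{∞,i}`"; the semi-graphs of the Galois tower are read off the quotients of
`π₁^temp(𝒢)`) [cite: MochizukiSemiAnbd2006, Thm 3.7(iii) p.41].

PURE GROUP THEORY (cell row T54-B, tower third, file T3b′; plan/GAP-LEDGER.md G-w4d053-1).  The variant of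
`SubgroupPresentationMap.lean` with a PRESCRIBED target presentation: for `f : Γ →* Γ'`, presentations `P`
(in `Γ`), `P'` (in `Γ'`) with `f(H_w) = H'_w`, `f(M_e) = M'_e`, `f(s_b) = s'_b`, and levels with
`f(K) = K'`, the morphism `P.cosetGraph K ⟶ P'.cosetGraph K'` (`y ↦ f y` on representatives — no
transport along equalities of presentations, so it COMPUTES), over `𝔾`, intertwining the deck actions,
and an isomorphism when `f` is surjective with `ker f ≤ K`.  Used for the transition maps of the
arithmetic tower (`f = Gal(𝒢_{∞,n+1}/𝒢) → Gal(𝒢_{∞,n}/𝒢)`) and for `π₁^temp(𝒢) ↠ Gal(𝒢_{∞,n}/𝒢)`.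
Nothing here bears on [IUTchIII] Cor. 3.12.
-/

namespace Literature.AnabelianGeometry.SemiGraphs

namespace SemiGraph

namespace SubgroupPresentation

open CategoryTheory

universe u

variable {𝔾 : SemiGraph.{u}} {Γ Γ' : Type u} [Group Γ] [Group Γ']
variable (P : SubgroupPresentation 𝔾 Γ) (P' : SubgroupPresentation 𝔾 Γ') (f : Γ →* Γ')
  (K : Subgroup Γ) (K' : Subgroup Γ')
  (hH : ∀ w, (P.H w).map f = P'.H w) (hM : ∀ e, (P.M e).map f = P'.M e)
  (hs : ∀ b, f (P.s b) = P'.s b) (hK : K.map f = K')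

/-- Pushing a double coset relation along `f` into prescribed image subgroups. [folklore] -/
private theorem mk_eq_of_mk_eq_to {L : Subgroup Γ} {L' : Subgroup Γ'} (hL : L.map f = L') (hK : K.map f = K')
    {y y' : Γ} (h : DoubleCoset.mk L K y = DoubleCoset.mk L K y') :
    DoubleCoset.mk L' K' (f y) = DoubleCoset.mk L' K' (f y') := by
  obtain ⟨a, ha, c, hc, rfl⟩ := (DoubleCoset.eq _ _ _ _).mp h
  exact (DoubleCoset.eq _ _ _ _).mpr ⟨f a, hL ▸ ⟨a, ha, rfl⟩, f c, hK ▸ ⟨c, hc, rfl⟩, by simp⟩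

/-- Pulling back, when `f` has kernel in `K`. [folklore] -/
private theorem mk_eq_of_mk_to_eq {L : Subgroup Γ} {L' : Subgroup Γ'} (hL : L.map f = L') (hK : K.map f = K')
    (hker : f.ker ≤ K) {y y' : Γ}
    (h : DoubleCoset.mk L' K' (f y) = DoubleCoset.mk L' K' (f y')) : DoubleCoset.mk L K y = DoubleCoset.mk L K y' := by
  obtain ⟨a', ha', c', hc', hy⟩ := (DoubleCoset.eq _ _ _ _).mp h
  rw [← hL] at ha'
  rw [← hK] at hc'
  obtain ⟨a, ha, rfl⟩ := ha'
  obtain ⟨c, hc, rfl⟩ := hc'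
  have hn : (a * y * c)⁻¹ * y' ∈ f.ker := by
    rw [MonoidHom.mem_ker, map_mul, map_inv, hy, map_mul, map_mul, inv_mul_cancel]
  refine (DoubleCoset.eq _ _ _ _).mpr ⟨a, ha, c * ((a * y * c)⁻¹ * y'), mul_mem hc (hker hn), ?_⟩
  group

include hH hM hs hK in
/-- **The morphism `P.cosetGraph K ⟶ P'.cosetGraph K'` along `f`** (`y ↦ f y` on representatives).
[cite: MochizukiSemiAnbd2006, Thm 3.7(iii) p.41] -/
def cosetGraphMapTo : P.cosetGraph K ⟶ P'.cosetGraph K' where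
  vertexMap x := ⟨x.1, Quotient.liftOn' x.2 (fun y => DoubleCoset.mk (P'.H x.1) K' (f y))
    (fun y y' h => mk_eq_of_mk_eq_to f K K' (hH x.1) hK (Quotient.sound' h))⟩
  edgeMap x := ⟨x.1, Quotient.liftOn' x.2 (fun y => DoubleCoset.mk (P'.M x.1) K' (f y))
    (fun y y' h => mk_eq_of_mk_eq_to f K K' (hM x.1) hK (Quotient.sound' h))⟩
  branchMap p := ⟨(p.1.1, ⟨p.1.2.1, Quotient.liftOn' p.1.2.2
    (fun y => DoubleCoset.mk (P'.M p.1.2.1) K' (f y))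
    (fun y y' h => mk_eq_of_mk_eq_to f K K' (hM p.1.2.1) hK (Quotient.sound' h))⟩), p.2⟩
  edgeOf_branchMap _ := rfl
  branchMap_injOn := by
    rintro ⟨⟨b₁, E₁⟩, h₁⟩ ⟨⟨b₂, E₂⟩, h₂⟩ (hE : E₁ = E₂) h
    subst hE
    have hb : b₁ = b₂ := congrArg (fun p : (P'.cosetGraph K').Branch => p.1.1) h
    subst hb
    rfl
  abuts_branchMap := by
    intro p x hx
    obtain ⟨b, y, rfl⟩ := P.bMk_surjective K p
    rcases hab : 𝔾.abuts b with _ | w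
    · rw [P.cosetGraph_abuts_bMk_none K b hab y] at hx
      exact absurd hx (by simp)
    · rw [P.cosetGraph_abuts_bMk K b w hab y] at hx
      cases hx
      change (P'.cosetGraph K').abuts (P'.bMk K' b (f y)) = some (P'.vMk K' w (f (P.s b * y)))
      rw [P'.cosetGraph_abuts_bMk K' b w hab (f y), map_mul, hs]

/-- On vertex representatives. [cite: MochizukiSemiAnbd2006, Thm 3.7(iii) p.41] -/
@[simp] theorem cosetGraphMapTo_vertexMap_vMk (w : 𝔾.Vertex) (y : Γ) :
    (cosetGraphMapTo P P' f K K' hH hM hs hK).vertexMap (P.vMk K w y) = P'.vMk K' w (f y) := rfl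

/-- On edge representatives. [cite: MochizukiSemiAnbd2006, Thm 3.7(iii) p.41] -/
@[simp] theorem cosetGraphMapTo_edgeMap_eMk (e : 𝔾.Edge) (y : Γ) :
    (cosetGraphMapTo P P' f K K' hH hM hs hK).edgeMap (P.eMk K e y) = P'.eMk K' e (f y) := rfl

/-- On branch representatives. [cite: MochizukiSemiAnbd2006, Thm 3.7(iii) p.41] -/
@[simp] theorem cosetGraphMapTo_branchMap_bMk (b : 𝔾.Branch) (y : Γ) :
    (cosetGraphMapTo P P' f K K' hH hM hs hK).branchMap (P.bMk K b y) = P'.bMk K' b (f y) := rfl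

/-- The morphism is over `𝔾`. [cite: MochizukiSemiAnbd2006, Thm 3.7(iii) p.41] -/
theorem cosetGraphMapTo_comp_proj :
    cosetGraphMapTo P P' f K K' hH hM hs hK ≫ P'.cosetGraphProj K' = P.cosetGraphProj K := by
  refine SemiGraph.hom_ext _ _ ?_ ?_ ?_ <;> rfl

/-- The morphism intertwines the deck actions: `deckAct K g ↦ deckAct K' (f g)`.
[cite: MochizukiSemiAnbd2006, Thm 3.7(iii) p.41] -/
theorem deckAct_comp_cosetGraphMapTo [K.Normal] [K'.Normal] (g : Γ) :
    (P.deckAct K g).hom ≫ cosetGraphMapTo P P' f K K' hH hM hs hK =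
      cosetGraphMapTo P P' f K K' hH hM hs hK ≫ (P'.deckAct K' (f g)).hom := by
  refine P.hom_ext_mk K _ _ (fun w y => ?_) (fun e y => ?_) (fun b y => ?_)
  · change (cosetGraphMapTo P P' f K K' hH hM hs hK).vertexMap (P.vMk K w (y * g⁻¹)) =
      (P'.deckAct K' (f g)).hom.vertexMap (P'.vMk K' w (f y))
    rw [cosetGraphMapTo_vertexMap_vMk, deckAct_vertexMap_vMk, map_mul, map_inv]
  · change (cosetGraphMapTo P P' f K K' hH hM hs hK).edgeMap (P.eMk K e (y * g⁻¹)) =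
      (P'.deckAct K' (f g)).hom.edgeMap (P'.eMk K' e (f y))
    rw [cosetGraphMapTo_edgeMap_eMk, deckAct_edgeMap_eMk, map_mul, map_inv]
  · change (cosetGraphMapTo P P' f K K' hH hM hs hK).branchMap (P.bMk K b (y * g⁻¹)) =
      (P'.deckAct K' (f g)).hom.branchMap (P'.bMk K' b (f y))
    rw [cosetGraphMapTo_branchMap_bMk, deckAct_branchMap_bMk, map_mul, map_inv]

/-- The morphism is bijective on vertices, edges and branches when `f` is surjective with
`ker f ≤ K`. [cite: MochizukiSemiAnbd2006, Thm 3.7(iii) p.41] -/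
theorem cosetGraphMapTo_bijective (hf : Function.Surjective f) (hker : f.ker ≤ K) :
    Function.Bijective (cosetGraphMapTo P P' f K K' hH hM hs hK).vertexMap ∧
      Function.Bijective (cosetGraphMapTo P P' f K K' hH hM hs hK).edgeMap ∧
      Function.Bijective (cosetGraphMapTo P P' f K K' hH hM hs hK).branchMap := by
  refine ⟨⟨?_, ?_⟩, ⟨?_, ?_⟩, ⟨?_, ?_⟩⟩
  · intro x x' h
    obtain ⟨w, y, rfl⟩ := P.vMk_surjective K x
    obtain ⟨w', y', rfl⟩ := P.vMk_surjective K x'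
    simp only [cosetGraphMapTo_vertexMap_vMk] at h
    obtain ⟨rfl, hq⟩ := Sigma.mk.inj_iff.mp h
    exact congrArg (Sigma.mk w) (mk_eq_of_mk_to_eq f K K' (hH w) hK hker (eq_of_heq hq))
  · intro x
    obtain ⟨w, y', rfl⟩ := P'.vMk_surjective K' x
    obtain ⟨y, rfl⟩ := hf y'
    exact ⟨P.vMk K w y, rfl⟩
  · intro x x' h
    obtain ⟨e, y, rfl⟩ := P.eMk_surjective K x
    obtain ⟨e', y', rfl⟩ := P.eMk_surjective K x'
    simp only [cosetGraphMapTo_edgeMap_eMk] at h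
    obtain ⟨rfl, hq⟩ := Sigma.mk.inj_iff.mp h
    exact congrArg (Sigma.mk e) (mk_eq_of_mk_to_eq f K K' (hM e) hK hker (eq_of_heq hq))
  · intro x
    obtain ⟨e, y', rfl⟩ := P'.eMk_surjective K' x
    obtain ⟨y, rfl⟩ := hf y'
    exact ⟨P.eMk K e y, rfl⟩
  · intro x x' h
    obtain ⟨b, y, rfl⟩ := P.bMk_surjective K x
    obtain ⟨b', y', rfl⟩ := P.bMk_surjective K x'
    simp only [cosetGraphMapTo_branchMap_bMk] at h
    have hb : b = b' := congrArg (fun p : (P'.cosetGraph K').Branch => p.1.1) h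
    subst hb
    have hq : DoubleCoset.mk (P'.M (𝔾.edgeOf b)) K' (f y) = DoubleCoset.mk (P'.M (𝔾.edgeOf b)) K' (f y') :=
      eq_of_heq (Sigma.mk.inj_iff.mp (congrArg (fun p : (P'.cosetGraph K').Branch => p.1.2) h)).2
    exact Subtype.ext (Prod.ext rfl
      (congrArg (Sigma.mk (𝔾.edgeOf b)) (mk_eq_of_mk_to_eq f K K' (hM _) hK hker hq)))
  · intro x
    obtain ⟨b, y', rfl⟩ := P'.bMk_surjective K' x
    obtain ⟨y, rfl⟩ := hf y'
    exact ⟨P.bMk K b y, rfl⟩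

/-- **`P.cosetGraph K ≅ P'.cosetGraph K'` along a surjection with `ker f ≤ K`** onto a prescribed target
presentation. [cite: MochizukiSemiAnbd2006, Thm 3.7(iii) p.41] -/
noncomputable def cosetGraphIsoTo (hf : Function.Surjective f) (hker : f.ker ≤ K) :
    P.cosetGraph K ≅ P'.cosetGraph K' :=
  SemiGraph.Hom.isoOfBijective (cosetGraphMapTo P P' f K K' hH hM hs hK)
    (cosetGraphMapTo_bijective P P' f K K' hH hM hs hK hf hker).1
    (cosetGraphMapTo_bijective P P' f K K' hH hM hs hK hf hker).2.1
    (cosetGraphMapTo_bijective P P' f K K' hH hM hs hK hf hker).2.2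
    (by
      intro p hp
      obtain ⟨b, y, rfl⟩ := P.bMk_surjective K p
      rcases hab : 𝔾.abuts b with _ | w
      · rw [cosetGraphMapTo_branchMap_bMk]
        exact P'.cosetGraph_abuts_bMk_none K' b hab (f y)
      · rw [P.cosetGraph_abuts_bMk K b w hab y] at hp
        exact absurd hp (by simp))

/-- The `hom` of `cosetGraphIsoTo`. [cite: MochizukiSemiAnbd2006, Thm 3.7(iii) p.41] -/
@[simp] theorem cosetGraphIsoTo_hom (hf : Function.Surjective f) (hker : f.ker ≤ K) :
    (cosetGraphIsoTo P P' f K K' hH hM hs hK hf hker).hom = cosetGraphMapTo P P' f K K' hH hM hs hK := rfl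

end SubgroupPresentation

end SemiGraph

end Literature.AnabelianGeometry.SemiGraphs
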